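import Literature.NumberTheory.Rogawski1990.LocalTransferCongruence
import Literature.MeasureTheory.Group.CosetSpaceLpTransport
import Literature.MeasureTheory.Group.InvariantQuotientOrbitalTransport
import HarnessLib

/-!
# (14.2.1) at an unramified place IS satisfied by `f_v := f′_v ∘ ψ_v⁻¹`: transport of orbital measure families along a
# class-preserving identification and `ψ`-equivariance of the (stable) orbital integrals — the analytic half of (L6)
(Rogawski (1990), §14.2 p. 232 «if `v ∉ S`, (14.2.1) is obviously satisfied»; Gelbart (1975), §10 pp. 154–155)

Topic `NumberTheory/Rogawski1990`; namespace `Literature.NumberTheory.Rogawski1990` (sequel of ★ `LocalTransferCongruence` (L6a) over ★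
`LocalTransfer` (LETTER #3)).  ONE definition with body (`OrbitalMeasureFamily.transport`) plus its two auxiliary choices
(`transportConj`, `transportEquiv`), and proved theorems; no named fact, no `sorry`, no instance.

For a bicontinuous group isomorphism `ψ : B ≃* A` and a family `m′` of orbital measures on `B` (one measure on `B ⧸ C(out c′)` per
conjugacy class `c′`, ★ `OrbitalMeasureFamily`), the **transported family** `ψ_* m′` on `A` assigns to a class `c` of `A` the
push-forward of `m′(ψ⁻¹ c)` along the measurable equivalence `B ⧸ C(out (ψ⁻¹ c)) ≃ᵐ A ⧸ C(out c)` induced by `ψ` followed by the inner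
automorphism and left translation that move `ψ(out (ψ⁻¹ c))` to the chosen representative `out c` (★ `cosetCongrMeasurableEquiv` + a
left translation — so NO invariance of `m′` is needed):

* §1 `classOrbitalIntegral_transport`: **`Φ([out c], f; ψ_* m′) = Φ([out (ψ⁻¹ c)], f ∘ ψ; m′)`** — orbital integrals transport EXACTLY
  (★ `integral_map_equiv`, ★ `descConj_cosetCongr_apply`, ★ `descConj_comp_conj_eq_descConj_smul`);
* §2 `stableOrbitalIntegralRel_transport`: for relations `stB`, `stA` intertwined by `ψ` and class functions in the second variable,
  **`Φ^st_A(ψ b, f; ψ_* m′) = Φ^st_B(b, f ∘ ψ; m′)`** (`finsum` reindexing along `ConjClasses.map ψ⁻¹`);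
* §3 unitary groups: for `ψ : U(σ,H′)(R) ≃* U(σ,H)(R)` bicontinuous and CLASS-PRESERVING (`γ′ ↔ ψ γ′`, ★ `Corresponds`), and every `f′`,
  **`isInnerTransfer_transport : IsInnerTransfer σ H H′ m′ (ψ_* m′) f′ (f′ ∘ ψ⁻¹)`** — (14.2.1) holds for `f := f′ ∘ ψ⁻¹` with the
  transported («compatible») measures (★ (L6a) `isInnerTransfer_of_forall_eq`); §4 the CM-local reading `isLocalInnerTransfer_transport` on the
  carriers `(UnitaryGroup.cmDatum L 3 ·).Local v` of ★ `IsLocalInnerTransfer`.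

For ARBITRARY (independently normalised) families the identity is false; the consumer (ENGINE T1 kit, ed. 1.15) quantifies the transported
family.  Borel σ-algebras on the orbit spaces are instance hypotheses.  (L6c) — the H-side unit ↦ unit = the fundamental lemma
[Rogawski1990, Prop. 4.9.1 (b)] — is a named fact, not here.  HC_CM is proved only modulo the printed citations until rung 0 closes.

## References
* [Rogawski1990] J. Rogawski, Ann. of Math. Stud. 123 (1990), §14.2 (14.2.1) p. 232.
* [Gelbart1975] S. Gelbart, *Automorphic forms on adele groups*, Ann. of Math. Stud. 83 (1975), §10 pp. 154–155 (orbital integrals matched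
  class by class along `G_S = G′_S`).
-/

set_option autoImplicit false

noncomputable section

open MeasureTheory NumberField IsDedekindDomain Topology
open scoped Matrix MatrixGroups

namespace Literature.NumberTheory.Rogawski1990

open Literature.MeasureTheory.Group Literature.NumberTheory.Automorphic
open Literature.AlgebraicGeometry.ShimuraVarieties (unitaryGroup)

/-! ## §1 Transport of orbital measure families along `ψ : B ≃* A` -/

section Transport

variable {A B : Type*} [Group A] [Group B] (ψ : B ≃* A)

/-- The class of `B` under a class `c` of `A`: `ψ⁻¹ c`. [cite: Gelbart1975, §10 pp. 154–155] -/
abbrev preClass (c : ConjClasses A) : ConjClasses B := c.map ψ.symm.toMonoidHom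

/-- `ψ⁻¹ c` is the class of `ψ⁻¹ (out c)`. [cite: Gelbart1975, §10 pp. 154–155] -/
theorem preClass_eq_mk (c : ConjClasses A) : preClass ψ c = ConjClasses.mk (ψ.symm (Quotient.out c : A)) := by
  conv_lhs => rw [preClass, ← Quotient.out_eq c]
  rfl

/-- `ψ (out (ψ⁻¹ c))` is conjugate to `out c` in `A`. [cite: Gelbart1975, §10 pp. 154–155] -/
theorem isConj_apply_out_preClass (c : ConjClasses A) :
    IsConj (ψ (Quotient.out (preClass ψ c) : B)) (Quotient.out c : A) := by
  have h1 : IsConj (Quotient.out (preClass ψ c) : B) (ψ.symm (Quotient.out c : A)) := by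
    rw [← ConjClasses.mk_eq_mk_iff_isConj, ← preClass_eq_mk]
    exact Quotient.out_eq _
  have h2 := ψ.toMonoidHom.map_isConj h1
  simpa only [MulEquiv.coe_toMonoidHom, MulEquiv.apply_symm_apply] using h2

/-- `ConjClasses.mk (out c) = c`. [folklore] -/
private theorem mk_out {X : Type*} [Monoid X] (q : ConjClasses X) : ConjClasses.mk (Quotient.out q) = q := by
  rw [← ConjClasses.quotient_mk_eq_mk, Quotient.out_eq]

/-- `ConjClasses.map ψ (ψ⁻¹ c) = c`. [cite: Gelbart1975, §10 pp. 154–155] -/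
theorem map_preClass (c : ConjClasses A) : (preClass ψ c).map ψ.toMonoidHom = c := by
  obtain ⟨a, rfl⟩ := ConjClasses.mk_surjective c
  change ConjClasses.mk (ψ (ψ.symm a)) = ConjClasses.mk a
  rw [MulEquiv.apply_symm_apply]

/-- `ψ⁻¹ (ConjClasses.map ψ c′) = c′`. [cite: Gelbart1975, §10 pp. 154–155] -/
theorem preClass_map (c' : ConjClasses B) : preClass ψ (c'.map ψ.toMonoidHom) = c' := by
  obtain ⟨b, rfl⟩ := ConjClasses.mk_surjective c'
  change ConjClasses.mk (ψ.symm (ψ b)) = ConjClasses.mk b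
  rw [MulEquiv.symm_apply_apply]

/-- `out (ψ⁻¹ c)` is conjugate (in `B`) to `ψ⁻¹ (out c)`. [cite: Gelbart1975, §10 pp. 154–155] -/
theorem isConj_out_preClass (c : ConjClasses A) : IsConj (Quotient.out (preClass ψ c) : B) (ψ.symm (Quotient.out c : A)) := by
  rw [← ConjClasses.mk_eq_mk_iff_isConj, ← preClass_eq_mk]
  exact Quotient.out_eq _

/-- A conjugator `x_c ∈ A` with `x_c · ψ(out (ψ⁻¹ c)) · x_c⁻¹ = out c` (a CHOICE). [cite: Gelbart1975, §10 pp. 154–155] -/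
def transportConj (c : ConjClasses A) : A :=
  Classical.choose (isConj_iff.1 (isConj_apply_out_preClass ψ c))

/-- The defining property of `transportConj`. [cite: Gelbart1975, §10 pp. 154–155] -/
theorem transportConj_spec (c : ConjClasses A) :
    transportConj ψ c * ψ (Quotient.out (preClass ψ c) : B) * (transportConj ψ c)⁻¹ = (Quotient.out c : A) :=
  Classical.choose_spec (isConj_iff.1 (isConj_apply_out_preClass ψ c))

/-- The isomorphism `e_c = conj(x_c) ∘ ψ : B ≃* A`, which maps `out (ψ⁻¹ c)` to `out c`. [cite: Gelbart1975, §10 pp. 154–155] -/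
def transportEquiv (c : ConjClasses A) : B ≃* A := ψ.trans (MulAut.conj (transportConj ψ c))

/-- `e_c (out (ψ⁻¹ c)) = out c`. [cite: Gelbart1975, §10 pp. 154–155] -/
theorem transportEquiv_out (c : ConjClasses A) : transportEquiv ψ c (Quotient.out (preClass ψ c) : B) = (Quotient.out c : A) := by
  rw [transportEquiv, MulEquiv.trans_apply, MulAut.conj_apply, transportConj_spec]

/-- `e_c b = x_c ψ(b) x_c⁻¹`. [cite: Gelbart1975, §10 pp. 154–155] -/
theorem transportEquiv_apply (c : ConjClasses A) (b : B) : transportEquiv ψ c b = transportConj ψ c * ψ b * (transportConj ψ c)⁻¹ := rfl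

variable [TopologicalSpace A] [TopologicalSpace B] [IsTopologicalGroup A] (hψ : Continuous ψ) (hψs : Continuous ψ.symm)

include hψ in
/-- `e_c` is continuous. [cite: Gelbart1975, §10 pp. 154–155] -/
theorem continuous_transportEquiv (c : ConjClasses A) : Continuous (transportEquiv ψ c) :=
  ((continuous_const.mul hψ).mul continuous_const :
    Continuous fun b => transportConj ψ c * ψ b * (transportConj ψ c)⁻¹)

include hψs in
/-- `e_c⁻¹` is continuous. [cite: Gelbart1975, §10 pp. 154–155] -/
theorem continuous_transportEquiv_symm (c : ConjClasses A) : Continuous (transportEquiv ψ c).symm := by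
  have h : ∀ a, (transportEquiv ψ c).symm a = ψ.symm ((transportConj ψ c)⁻¹ * a * transportConj ψ c) := fun a => by
    apply (transportEquiv ψ c).injective
    rw [MulEquiv.apply_symm_apply, transportEquiv_apply, MulEquiv.apply_symm_apply]
    group
  rw [show ((transportEquiv ψ c).symm : A → B) = fun a => ψ.symm ((transportConj ψ c)⁻¹ * a * transportConj ψ c) from funext h]
  exact hψs.comp ((continuous_const.mul continuous_id).mul continuous_const)

variable [∀ a : A, MeasurableSpace (A ⧸ Subgroup.centralizer ({a} : Set A))] [∀ a : A, BorelSpace (A ⧸ Subgroup.centralizer ({a} : Set A))]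
  [∀ b : B, MeasurableSpace (B ⧸ Subgroup.centralizer ({b} : Set B))] [∀ b : B, BorelSpace (B ⧸ Subgroup.centralizer ({b} : Set B))]

/-- The measurable equivalence of orbit spaces `B ⧸ C(out (ψ⁻¹ c)) ≃ᵐ A ⧸ C(out c)`: `y C ↦ x_c⁻¹ · e_c(y) C(out c)` (★ `cosetCongrMeasurableEquiv`
for `e_c`, then the left translation by `x_c⁻¹`). [cite: Gelbart1975, §10 pp. 154–155] -/
def transportOrbitEquiv (c : ConjClasses A) :
    B ⧸ Subgroup.centralizer ({(Quotient.out (preClass ψ c) : B)} : Set B) ≃ᵐ A ⧸ Subgroup.centralizer ({(Quotient.out c : A)} : Set A) :=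
  (cosetCongrMeasurableEquiv (transportEquiv ψ c) _ _
      (forall_apply_mem_centralizer_singleton_iff_of_eq (transportEquiv ψ c) (transportEquiv_out ψ c))
      (continuous_transportEquiv ψ hψ c) (continuous_transportEquiv_symm ψ hψs c)).trans
    (MeasurableEquiv.smul ((transportConj ψ c)⁻¹ : A))

/-- **The transported family `ψ_* m′`** of orbital measures: on the class `c` of `A`, the push-forward of `m′(ψ⁻¹ c)` along
`transportOrbitEquiv`. [cite: Gelbart1975, §10 pp. 154–155] -/
def _root_.Literature.NumberTheory.Automorphic.OrbitalMeasureFamily.transport (m' : OrbitalMeasureFamily B) : OrbitalMeasureFamily A :=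
  fun c => Measure.map (transportOrbitEquiv ψ hψ hψs c) (m' (preClass ψ c))

/-- **Orbital integrals transport exactly**: `Φ([out c], f; ψ_* m′) = Φ([out (ψ⁻¹ c)], f ∘ ψ; m′)` for every `f : A → ℂ` — no invariance of
the measures is used (the inner automorphism in `e_c` is undone by the left translation). [cite: Gelbart1975, §10 pp. 154–155] -/
theorem classOrbitalIntegral_transport (m' : OrbitalMeasureFamily B) (f : A → ℂ) (c : ConjClasses A) :
    classOrbitalIntegral (m'.transport ψ hψ hψs) f c = classOrbitalIntegral m' (f ∘ ψ) (preClass ψ c) := by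
  rw [classOrbitalIntegral_eq, classOrbitalIntegral_eq, orbitalIntegral_eq_integral_descConj, orbitalIntegral_eq_integral_descConj,
    OrbitalMeasureFamily.transport, integral_map_equiv]
  refine integral_congr_ae (Filter.Eventually.of_forall fun y => ?_)
  -- the integrand at `x_c⁻¹ • e_c(y)`
  change descConj (Quotient.out c : A) _ (centralizer_comm _) f
      ((transportConj ψ c)⁻¹ • cosetCongr (transportEquiv ψ c) _ _
        (forall_apply_mem_centralizer_singleton_iff_of_eq (transportEquiv ψ c) (transportEquiv_out ψ c)) y) = _
  rw [← descConj_comp_conj_eq_descConj_smul, descConj_cosetCongr_apply (transportEquiv ψ c) (transportEquiv_out ψ c)]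
  congr 1
  funext b
  simp only [Function.comp_apply, MulAut.conj_apply, transportEquiv_apply]
  congr 1
  group

/-! ## §2 Stable orbital integrals: `Φ^st_A(ψ b, f; ψ_* m′) = Φ^st_B(b, f ∘ ψ; m′)` -/

/-- **`Φ^st` transports**: for relations `stA` on `A`, `stB` on `B` INTERTWINED by `ψ` (`stB b b′ ↔ stA (ψ b) (ψ b′)`) and class functions in
the second variable (`IsConj y y′ → (stB b y ↔ stB b y′)`, likewise for `stA`), `Φ^st_A(ψ b, f; ψ_* m′) = Φ^st_B(b, f ∘ ψ; m′)` — reindex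
the `finsum` over the classes of `A` in `𝒪_st(ψ b)` along `c ↦ ψ⁻¹ c` and use §1. [cite: Rogawski1990, §14.2 p. 232] -/
theorem stableOrbitalIntegralRel_transport (stA : A → A → Prop) (stB : B → B → Prop)
    (hst : ∀ b b', stB b b' ↔ stA (ψ b) (ψ b')) (hA : ∀ a y y', IsConj y y' → (stA a y ↔ stA a y'))
    (hB : ∀ b y y', IsConj y y' → (stB b y ↔ stB b y'))
    (m' : OrbitalMeasureFamily B) (f : A → ℂ) (b : B) :
    stableOrbitalIntegralRel stA (m'.transport ψ hψ hψs) f (ψ b) = stableOrbitalIntegralRel stB m' (f ∘ ψ) b := by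
  rw [stableOrbitalIntegralRel_def, stableOrbitalIntegralRel_def]
  refine finsum_mem_eq_of_bijOn (fun c => preClass ψ c) ⟨fun c hc => ?_, fun c₁ _ c₂ _ h => ?_, fun c' hc' => ?_⟩ fun c _ =>
    classOrbitalIntegral_transport ψ hψ hψs m' f c
  · -- maps `𝒪_st(ψ b)` into `𝒪_st(b)`
    rw [Set.mem_setOf_eq] at hc ⊢
    rw [hB b _ _ (isConj_out_preClass ψ c), hst, MulEquiv.apply_symm_apply]
    exact hc
  · -- injective
    have h' : preClass ψ c₁ = preClass ψ c₂ := h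
    rw [← map_preClass ψ c₁, ← map_preClass ψ c₂, h']
  · -- surjective
    refine ⟨c'.map ψ.toMonoidHom, ?_, preClass_map ψ c'⟩
    rw [Set.mem_setOf_eq] at hc' ⊢
    have h1 : IsConj (Quotient.out (c'.map ψ.toMonoidHom) : A) (ψ (Quotient.out c' : B)) := by
      rw [← ConjClasses.mk_eq_mk_iff_isConj, mk_out]
      conv_lhs => rw [← mk_out c']
      rfl
    rw [hA _ _ _ h1, ← hst]
    exact hc'

end Transport

/-! ## §3 Unitary groups: `f′ ↦ f′ ∘ ψ⁻¹` IS a transfer (14.2.1) for the transported measures -/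

section Unitary

variable {R : Type*} [CommRing R] [TopologicalSpace R] [IsTopologicalRing R] {n : Type*} [Fintype n] [DecidableEq n]
  {σ : R →+* R} {H H' : Matrix n n R}
  [∀ γ : unitaryGroup σ H, MeasurableSpace (unitaryGroup σ H ⧸ Subgroup.centralizer ({γ} : Set (unitaryGroup σ H)))]
  [∀ γ : unitaryGroup σ H, BorelSpace (unitaryGroup σ H ⧸ Subgroup.centralizer ({γ} : Set (unitaryGroup σ H)))]
  [∀ γ : unitaryGroup σ H', MeasurableSpace (unitaryGroup σ H' ⧸ Subgroup.centralizer ({γ} : Set (unitaryGroup σ H')))]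
  [∀ γ : unitaryGroup σ H', BorelSpace (unitaryGroup σ H' ⧸ Subgroup.centralizer ({γ} : Set (unitaryGroup σ H')))]

/-- **`Φ^st_H(ψ γ′, f′ ∘ ψ⁻¹; ψ_* m′) = Φ^st_{H′}(γ′, f′; m′)`** for a bicontinuous class-preserving `ψ : U(H′) ≃* U(H)`.
[cite: Rogawski1990, §14.2 (14.2.1) p. 232] -/
theorem stableOrbitalIntegral_transport_comp_symm (ψ : unitaryGroup σ H' ≃* unitaryGroup σ H) (hψ : Continuous ψ)
    (hψs : Continuous ψ.symm) (hcl : ∀ γ', Corresponds σ H' H γ' (ψ γ')) (m' : OrbitalMeasureFamily (unitaryGroup σ H'))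
    (f' : unitaryGroup σ H' → ℂ) (γ' : unitaryGroup σ H') :
    stableOrbitalIntegral σ H (m'.transport ψ hψ hψs) (f' ∘ ψ.symm) (ψ γ') = stableOrbitalIntegral σ H' m' f' γ' := by
  have h := stableOrbitalIntegralRel_transport ψ hψ hψs (IsStablyConj σ H) (IsStablyConj σ H')
    (fun b b' => isStablyConj_iff_of_corresponds ψ hcl b b')
    (fun a y y' hc => ⟨fun h => h.trans (isStablyConj_of_isConj hc), fun h => h.trans (isStablyConj_of_isConj hc).symm⟩)
    (fun b y y' hc => ⟨fun h => h.trans (isStablyConj_of_isConj hc), fun h => h.trans (isStablyConj_of_isConj hc).symm⟩)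
    m' (f' ∘ ψ.symm) γ'
  have hcomp : (f' ∘ ψ.symm) ∘ ψ = f' := funext fun b => by simp only [Function.comp_apply, MulEquiv.symm_apply_apply]
  rw [hcomp] at h
  exact h

/-- **(14.2.1) holds for `f := f′ ∘ ψ⁻¹` with the transported measures**: for a bicontinuous CLASS-PRESERVING identification
`ψ : U(σ,H′)(R) ≃* U(σ,H)(R)` (e.g. of congruence type) and EVERY `f′`, `IsInnerTransfer σ H H′ m′ (ψ_* m′) f′ (f′ ∘ ψ⁻¹)` — «if `v ∉ S`,
(14.2.1) is obviously satisfied». [cite: Rogawski1990, §14.2 (14.2.1) p. 232] -/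
theorem isInnerTransfer_transport (ψ : unitaryGroup σ H' ≃* unitaryGroup σ H) (hψ : Continuous ψ) (hψs : Continuous ψ.symm)
    (hcl : ∀ γ', Corresponds σ H' H γ' (ψ γ')) (m' : OrbitalMeasureFamily (unitaryGroup σ H')) (f' : unitaryGroup σ H' → ℂ) :
    IsInnerTransfer σ H H' m' (m'.transport ψ hψ hψs) f' (f' ∘ ψ.symm) :=
  isInnerTransfer_of_forall_eq ψ hcl ψ.surjective fun γ' _ => stableOrbitalIntegral_transport_comp_symm ψ hψ hψs hcl m' f' γ'

end Unitary

/-! ## §4 The CM-local reading on `(UnitaryGroup.cmDatum L 3 ·).Local v` -/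

section CM

variable (L : Type) [Field L] [NumberField L] [IsCMField L] (H' : Matrix (Fin 3) (Fin 3) L)
  (v : HeightOneSpectrum (𝓞 ↥(maximalRealSubfield L)))

/-- **`f′_v ↦ f_v := f′_v ∘ ψ_v⁻¹` IS a local transfer (14.2.1) at `v`, for the transported measures**: for a class-preserving
identification `ψ_v : U(H′)(L⁺_v) ≃ₜ* U(Φ₃)(L⁺_v)` of topological groups (★ `localFormCongr` ∕ the congruence-type `ψ_v` of the inner form,
★ `corresponds_localFormCongr`) and EVERY `f′_v`, `IsLocalInnerTransfer L H′ v m′ (ψ_* m′) f′_v (f′_v ∘ ψ_v⁻¹)` — [Rogawski1990, §14.2]: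
«if `v ∉ S`, (14.2.1) is obviously satisfied» (away from `S₀ ∪ S`, with `f′_v`, `f_v` the units this is the unramified local transfer).
Borel σ-algebras on the orbit spaces are hypotheses. [cite: Rogawski1990, §14.2 (14.2.1) p. 232] -/
theorem isLocalInnerTransfer_transport
    [∀ γ : (UnitaryGroup.cmDatum L 3 H').Local v,
      MeasurableSpace ((UnitaryGroup.cmDatum L 3 H').Local v ⧸ Subgroup.centralizer ({γ} : Set ((UnitaryGroup.cmDatum L 3 H').Local v)))]
    [∀ γ : (UnitaryGroup.cmDatum L 3 H').Local v,
      BorelSpace ((UnitaryGroup.cmDatum L 3 H').Local v ⧸ Subgroup.centralizer ({γ} : Set ((UnitaryGroup.cmDatum L 3 H').Local v)))]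
    [∀ γ : (UnitaryGroup.cmDatum L 3 (Matrix.of fun i j : Fin 3 => if i.val + j.val + 1 = 3 then (1 : L) else 0)).Local v,
      MeasurableSpace ((UnitaryGroup.cmDatum L 3 (Matrix.of fun i j : Fin 3 => if i.val + j.val + 1 = 3 then (1 : L) else 0)).Local v ⧸
        Subgroup.centralizer ({γ} : Set ((UnitaryGroup.cmDatum L 3 (Matrix.of fun i j : Fin 3 => if i.val + j.val + 1 = 3 then (1 : L) else 0)).Local v)))]
    [∀ γ : (UnitaryGroup.cmDatum L 3 (Matrix.of fun i j : Fin 3 => if i.val + j.val + 1 = 3 then (1 : L) else 0)).Local v,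
      BorelSpace ((UnitaryGroup.cmDatum L 3 (Matrix.of fun i j : Fin 3 => if i.val + j.val + 1 = 3 then (1 : L) else 0)).Local v ⧸
        Subgroup.centralizer ({γ} : Set ((UnitaryGroup.cmDatum L 3 (Matrix.of fun i j : Fin 3 => if i.val + j.val + 1 = 3 then (1 : L) else 0)).Local v)))]
    (ψ : (UnitaryGroup.cmDatum L 3 H').Local v ≃ₜ*
      (UnitaryGroup.cmDatum L 3 (Matrix.of fun i j : Fin 3 => if i.val + j.val + 1 = 3 then (1 : L) else 0)).Local v)
    (hcl : ∀ γ', Corresponds (UnitaryGroup.conjLocal L (IsCMField.complexConj L) v)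
      ((UnitaryGroup.adelicForm L 3 H').map (UnitaryGroup.adeleToLocal L v))
      ((UnitaryGroup.adelicForm L 3 (Matrix.of fun i j : Fin 3 => if i.val + j.val + 1 = 3 then (1 : L) else 0)).map
        (UnitaryGroup.adeleToLocal L v)) γ' (ψ γ'))
    (m' : OrbitalMeasureFamily ((UnitaryGroup.cmDatum L 3 H').Local v)) (f' : (UnitaryGroup.cmDatum L 3 H').Local v → ℂ) :
    IsLocalInnerTransfer L H' v m' (m'.transport ψ.toMulEquiv ψ.continuous ψ.symm.continuous) f' (f' ∘ ψ.symm) := by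
  refine (isLocalInnerTransfer_iff_forall_eq L H' v ψ hcl ψ.surjective m' _ f' _).2 fun γ' _ => ?_
  -- `Φ^st(ψ γ′, f′ ∘ ψ⁻¹; ψ_* m′) = Φ^st(γ′, (f′ ∘ ψ⁻¹) ∘ ψ; m′)` by §2
  have h := stableOrbitalIntegralRel_transport
    (A := (UnitaryGroup.cmDatum L 3 (Matrix.of fun i j : Fin 3 => if i.val + j.val + 1 = 3 then (1 : L) else 0)).Local v)
    (B := (UnitaryGroup.cmDatum L 3 H').Local v) ψ.toMulEquiv ψ.continuous ψ.symm.continuous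
    (IsStablyConj (UnitaryGroup.conjLocal L (IsCMField.complexConj L) v)
      ((UnitaryGroup.adelicForm L 3 (Matrix.of fun i j : Fin 3 => if i.val + j.val + 1 = 3 then (1 : L) else 0)).map
        (UnitaryGroup.adeleToLocal L v)))
    (IsStablyConj (UnitaryGroup.conjLocal L (IsCMField.complexConj L) v)
      ((UnitaryGroup.adelicForm L 3 H').map (UnitaryGroup.adeleToLocal L v)))
    (fun b b' => ⟨fun hb => ((hcl b).symm.trans hb).trans (hcl b'), fun hb => ((hcl b).trans hb).trans (hcl b').symm⟩)
    (fun _ y y' hc => by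
      have hGL : IsConj y.val y'.val :=
        (UnitaryGroup.«local» L (IsCMField.complexConj L) 3
          (Matrix.of fun i j : Fin 3 => if i.val + j.val + 1 = 3 then (1 : L) else 0) v).subtype.map_isConj hc
      exact ⟨fun h' => h'.trans hGL, fun h' => h'.trans hGL.symm⟩)
    (fun _ y y' hc => by
      have hGL : IsConj y.val y'.val := (UnitaryGroup.«local» L (IsCMField.complexConj L) 3 H' v).subtype.map_isConj hc
      exact ⟨fun h' => h'.trans hGL, fun h' => h'.trans hGL.symm⟩)
    m' (f' ∘ ψ.symm) γ'
  have hcomp : ((f' ∘ ψ.symm) ∘ (ψ.toMulEquiv : (UnitaryGroup.cmDatum L 3 H').Local v →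
      (UnitaryGroup.cmDatum L 3 (Matrix.of fun i j : Fin 3 => if i.val + j.val + 1 = 3 then (1 : L) else 0)).Local v)) = f' :=
    funext fun b => by
      show f' (ψ.symm (ψ b)) = f' b
      rw [ContinuousMulEquiv.symm_apply_apply]
  rw [hcomp] at h
  exact h

end CM

end Literature.NumberTheory.Rogawski1990

end
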